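import Summits.CriticalPhenomena.CardyFormulaZ2.Theorems.CardySusyWardDiscretisationFamilyExistsSidesA
import Summits.CriticalPhenomena.CardyFormulaZ2.Theorems.CardySusyWardDiscretisationFamilyExistsChi
import Literature.Topology.PlaneTopology.CrosscutProofs
import HarnessLib

/-!
# The labelling of the discrete boundary by the two sides of the cross-cut — helper for `DiscretisationFamilyExists` (stmt-CriticalPhenomena-9644)

Fixed mesh.  `labelling_of_crosscut`: given the two legs at the marked points of a Dobrushin
domain, the cross-cut `χ` through them with its recorded facts (`…ExistsChi`), boundary
parameters `s < t < s + 1` of its ends close to the marks, and the local control of the boundary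
loop at the marks, the labels `SA = {x ∈ ∂Ω_δ | δx ∈ U₁}`, `SB = {x ∈ ∂Ω_δ | δx ∈ U₂}` by the two
Newman sides of `χ` satisfy the ten properties consumed by
`zdDiscretisationFamily_of_labelling` at this mesh, with `ε = η + η₁ + 2δ`, and the two cut
midpoints are within `η₁` of the marked points.
-/

noncomputable section

open Set Metric
open Literature.Probability.LatticeModels Literature.Probability.Percolation
  Literature.Probability.LatticeModels.DiscreteDobrushin Literature.Probability.RandomPlanarGeometry
  Literature.Topology.PlaneTopology

namespace Summit.CriticalPhenomena.CardyFormulaZ2.Theorems.DiscretisationFamilyExists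

/-- Membership of both ends in a pair. [folklore] -/
theorem forall_mem_sym2_iff {α : Type*} {P : α → Prop} {a b : α} : (∀ x ∈ s(a, b), P x) ↔ P a ∧ P b :=
  ⟨fun h => ⟨h a (Sym2.mem_mk_left a b), h b (Sym2.mem_mk_right a b)⟩,
    fun h x hx => by rcases Sym2.mem_iff.1 hx with rfl | rfl; exacts [h.1, h.2]⟩

set_option maxHeartbeats 3200000 in
/-- **The labelling by the two sides of the cross-cut.** See the module docstring. [folklore] -/
theorem labelling_of_crosscut (D : DobrushinDomain) {δ η η₁ κ₀ κ₁ : ℝ} (hδ : 0 < δ) (hη : 0 < η)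
    {pa pb : ℂ} (La : LegData D.carrier δ (D.pt 0) η₁ pa) (Lb : LegData D.carrier δ (D.pt 1) η₁ pb)
    (hsep : 2 * η₁ + 12 * δ ≤ dist (D.pt 0) (D.pt 1))
    {χ : Set ℂ} (hcross : D.toJordanDomain.IsCrosscut χ La.c Lb.c)
    (hBχ : ∀ x ∈ (⟨D.carrier, δ, ∅, ∅⟩ : DiscreteDobrushin).zdBoundary, meshPoint δ x ∉ χ)
    (hedge : ∀ x ∈ (⟨D.carrier, δ, ∅, ∅⟩ : DiscreteDobrushin).zdBoundary,
      ∀ y ∈ (⟨D.carrier, δ, ∅, ∅⟩ : DiscreteDobrushin).zdBoundary,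
      (discreteDomainGraph D.carrier δ).Adj x y →
      χ ∩ segment ℝ (meshPoint δ x) (meshPoint δ y) ⊆ {La.pstar, Lb.pstar})
    (hz₀a : La.z₀ ∈ χ) (hz₀b : Lb.z₀ ∈ χ)
    (hsecA : χ ∩ ball La.z₀ La.ε ⊆ {z | inner (ℝ) (z - La.z₀) (meshPoint δ La.v - meshPoint δ La.u) = 0})
    (hsecB : χ ∩ ball Lb.z₀ Lb.ε ⊆ {z | inner (ℝ) (z - Lb.z₀) (meshPoint δ Lb.v - meshPoint δ Lb.u) = 0})
    (haUa : ∃ q ∈ ball La.z₀ La.ε, 0 < inner (ℝ) (q - La.z₀) (meshPoint δ La.u - meshPoint δ La.v) ∧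
      segment ℝ (meshPoint δ La.u) q ⊆ D.carrier \ χ)
    (haVa : ∃ q ∈ ball La.z₀ La.ε, 0 < inner (ℝ) (q - La.z₀) (meshPoint δ La.v - meshPoint δ La.u) ∧
      segment ℝ (meshPoint δ La.v) q ⊆ D.carrier \ χ)
    (haUb : ∃ q ∈ ball Lb.z₀ Lb.ε, 0 < inner (ℝ) (q - Lb.z₀) (meshPoint δ Lb.u - meshPoint δ Lb.v) ∧
      segment ℝ (meshPoint δ Lb.u) q ⊆ D.carrier \ χ)
    (haVb : ∃ q ∈ ball Lb.z₀ Lb.ε, 0 < inner (ℝ) (q - Lb.z₀) (meshPoint δ Lb.v - meshPoint δ Lb.u) ∧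
      segment ℝ (meshPoint δ Lb.v) q ⊆ D.carrier \ χ)
    (hbVa : ∀ p ∈ χ, p ∈ D.carrier → ∀ α β : ℝ, 0 ≤ α → α ≤ 2 → -1 ≤ β → β ≤ 1 →
      p ≠ meshPoint δ La.v + α • meshPoint δ (cornerUnit La.mv) + β • meshPoint δ (cornerUnit (La.mv + 1)))
    (hbUa : ∀ p ∈ χ, p ∈ D.carrier → ∀ α β : ℝ, 0 ≤ α → α ≤ 2 → -1 ≤ β → β ≤ 1 →
      p ≠ meshPoint δ La.u + α • meshPoint δ (cornerUnit (La.mv + 2)) + β • meshPoint δ (cornerUnit (La.mv + 2 + 1)))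
    (hbVb : ∀ p ∈ χ, p ∈ D.carrier → ∀ α β : ℝ, 0 ≤ α → α ≤ 2 → -1 ≤ β → β ≤ 1 →
      p ≠ meshPoint δ Lb.v + α • meshPoint δ (cornerUnit Lb.mv) + β • meshPoint δ (cornerUnit (Lb.mv + 1)))
    (hbUb : ∀ p ∈ χ, p ∈ D.carrier → ∀ α β : ℝ, 0 ≤ α → α ≤ 2 → -1 ≤ β → β ≤ 1 →
      p ≠ meshPoint δ Lb.u + α • meshPoint δ (cornerUnit (Lb.mv + 2)) + β • meshPoint δ (cornerUnit (Lb.mv + 2 + 1)))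
    (hnear : ∀ z ∈ χ, z ∈ ball (D.pt 0) η₁ ∨ z ∈ ball (D.pt 1) η₁ ∨ 20 * δ < infDist z (frontier D.carrier))
    {s t : ℝ} (hs : D.boundary s = La.c) (ht : D.boundary t = Lb.c) (hst : s < t) (hts : t < s + 1)
    (hsm : |s - D.mark 0| < κ₀) (htm : |t - D.mark 1| < κ₁)
    (hloc₀ : ∀ u : ℝ, |u - D.mark 0| ≤ κ₀ → dist (D.boundary u) (D.pt 0) < η)
    (hloc₁ : ∀ u : ℝ, |u - D.mark 1| ≤ κ₁ → dist (D.boundary u) (D.pt 1) < η) :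
    ∃ SA SB : Set (Site 2),
      (SA ∪ SB = (⟨D.carrier, δ, ∅, ∅⟩ : DiscreteDobrushin).zdBoundary ∧
      Disjoint SA SB ∧ SA.Nonempty ∧ SB.Nonempty ∧
      (∀ y ∈ SA, ¬ Metric.closedBall (meshPoint δ y)
          (Metric.infDist (meshPoint δ y) (frontier D.carrier)) ⊆
        ⋃ x ∈ SB, Metric.closedBall (meshPoint δ x)
          (Metric.infDist (meshPoint δ x) (frontier D.carrier))) ∧
      (∀ x ∈ SB, ¬ Metric.closedBall (meshPoint δ x)
          (Metric.infDist (meshPoint δ x) (frontier D.carrier)) ⊆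
        ⋃ y ∈ SA, Metric.closedBall (meshPoint δ y)
          (Metric.infDist (meshPoint δ y) (frontier D.carrier))) ∧
      (∀ y ∈ SA, Metric.infDist (meshPoint δ y) (D.arc 0) ≤ η + η₁ + 2 * δ) ∧
      (∀ x ∈ SB, Metric.infDist (meshPoint δ x) (D.arc 1) ≤ η + η₁ + 2 * δ) ∧
      {e | e ∈ (discreteDomainGraph D.carrier δ).edgeSet ∧ (∃ x ∈ e, x ∈ SA) ∧
        ∃ y ∈ e, y ∈ SB}.ncard = 2 ∧
      ∀ e ∈ (discreteDomainGraph D.carrier δ).edgeSet, (∃ x ∈ e, x ∈ SA) → (∃ y ∈ e, y ∈ SB) →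
        ∃! f, (⟨D.carrier, δ, ∅, ∅⟩ : DiscreteDobrushin).IsInnerFace f ∧ ∀ x ∈ e, IsCorner x f) ∧
      Metric.hausdorffEDist (medialPoint δ ''
        {e | e ∈ (discreteDomainGraph D.carrier δ).edgeSet ∧ (∃ x ∈ e, x ∈ SA) ∧
          ∃ y ∈ e, y ∈ SB}) {D.pt 0, D.pt 1} ≤ ENNReal.ofReal η₁ := by
  obtain ⟨hΩ, hext, hunb, hJE⟩ := regular_of_eq_carrier (D := ⟨D.carrier, δ, ∅, ∅⟩) D.toJordanDomain rfl
  dsimp only at hΩ hext hunb hJE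
  -- the two Newman sides
  obtain ⟨U₁, U₂, hU₁o, hU₂o, -, -, hdisj, hunion, hf₁, hf₂⟩ :=
    Newman1939_crosscut_holds D.toJordanDomain χ s t hst hts (by rw [hs, ht]; exact hcross)
  obtain ⟨harc, hcafr, hcbfr, hcab, hχΩ⟩ := hcross
  have hχcl : IsClosed χ := harc.isCompact.isClosed
  have hcaχ : La.c ∈ χ := harc.left_mem
  have hcbχ : Lb.c ∈ χ := harc.right_mem
  have hU₁Ω : U₁ ⊆ D.carrier := fun z hz => ((hunion ▸ Or.inl hz : z ∈ D.carrier \ χ)).1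
  have hU₂Ω : U₂ ⊆ D.carrier := fun z hz => ((hunion ▸ Or.inr hz : z ∈ D.carrier \ χ)).1
  have hU₁χ : ∀ z ∈ U₁, z ∉ χ := fun z hz => ((hunion ▸ Or.inl hz : z ∈ D.carrier \ χ)).2
  have hU₂χ : ∀ z ∈ U₂, z ∉ χ := fun z hz => ((hunion ▸ Or.inr hz : z ∈ D.carrier \ χ)).2
  have hcover : D.carrier \ χ ⊆ U₁ ∪ U₂ := hunion.symm.subset
  have hD : D.carrier ⊆ U₁ ∪ U₂ ∪ χ := fun z hz => by
    by_cases h : z ∈ χ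
    · exact Or.inr h
    · exact Or.inl (hcover ⟨hz, h⟩)
  have hfr : frontier U₁ ∩ frontier U₂ ⊆ χ := by
    rintro z ⟨hz1, hz2⟩
    rw [hf₁] at hz1; rw [hf₂] at hz2
    rcases hz1 with h | ⟨u, hu, rfl⟩
    · exact h
    rcases hz2 with h | ⟨u', hu', heq⟩
    · exact h
    rcases eq_or_lt_of_le hu'.2 with h' | h'
    · rw [← heq, h', D.periodic_boundary, hs]; exact hcaχ
    · have := D.injOn_boundary_Ico s ⟨hu'.1.trans' hst.le |> fun h => hst.le.trans hu'.1, h'⟩ ⟨hu.1, by linarith [hu.2]⟩ heq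
      rw [← this] at hu
      have hut : u' = t := le_antisymm (by linarith [hu.2]) hu'.1
      rw [← heq, hut, ht]; exact hcbχ
  -- basic facts on boundary sites
  have hBΩ : ∀ x ∈ (⟨D.carrier, δ, ∅, ∅⟩ : DiscreteDobrushin).zdBoundary, meshPoint δ x ∈ D.carrier := fun x hx =>
    meshDomain_subset_meshVertices _ _ (DiscreteDobrushin.zdBoundary_subset_meshDomain _ hx)
  have hBU : ∀ x ∈ (⟨D.carrier, δ, ∅, ∅⟩ : DiscreteDobrushin).zdBoundary, meshPoint δ x ∈ U₁ ∪ U₂ := fun x hx =>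
    hcover ⟨hBΩ x hx, hBχ x hx⟩
  have hfin : ((⟨D.carrier, δ, ∅, ∅⟩ : DiscreteDobrushin).zdBoundary).Finite :=
    (meshDomain_finite D.isBounded hδ).subset (DiscreteDobrushin.zdBoundary_subset_meshDomain _)
  -- same side along a segment of `Ω \ χ` from a boundary site
  have hsame : ∀ (x q : ℂ), segment ℝ x q ⊆ D.carrier \ χ → x ∈ U₁ ∪ U₂ →
      (q ∈ U₁ → x ∈ U₁) ∧ (q ∈ U₂ → x ∈ U₂) := by
    intro x q hseg hx
    have hseg' : segment ℝ q x ⊆ closure D.carrier := by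
      rw [segment_symm]; exact fun z hz => subset_closure (hseg hz).1
    have hdis : Disjoint (segment ℝ q x) χ := Set.disjoint_left.2 fun z hz hzχ => by
      rw [segment_symm] at hz; exact (hseg hz).2 hzχ
    have := mem_of_segment hU₁o hU₂o hdisj hχcl hD hfr hseg' hdis
    exact ⟨fun hq => this.1 hq hx, fun hq => this.2 hq hx⟩
  -- orientation of the cut edge at `a` and at `b`
  have horient : ∀ {c' : ℂ} {η' : ℝ} {p' : ℂ} (L : LegData D.carrier δ c' η' p'), L.z₀ ∈ χ →
      χ ∩ ball L.z₀ L.ε ⊆ {z | inner (ℝ) (z - L.z₀) (meshPoint δ L.v - meshPoint δ L.u) = 0} →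
      (∃ q ∈ ball L.z₀ L.ε, 0 < inner (ℝ) (q - L.z₀) (meshPoint δ L.u - meshPoint δ L.v) ∧
        segment ℝ (meshPoint δ L.u) q ⊆ D.carrier \ χ) →
      (∃ q ∈ ball L.z₀ L.ε, 0 < inner (ℝ) (q - L.z₀) (meshPoint δ L.v - meshPoint δ L.u) ∧
        segment ℝ (meshPoint δ L.v) q ⊆ D.carrier \ χ) →
      (meshPoint δ L.v ∈ U₁ ∧ meshPoint δ L.u ∈ U₂) ∨ (meshPoint δ L.v ∈ U₂ ∧ meshPoint δ L.u ∈ U₁) := by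
    intro c' η' p' L hz₀ hsec haU haV
    obtain ⟨qu, hqu, hquw, hqus⟩ := haU
    obtain ⟨qv, hqv, hqvw, hqvs⟩ := haV
    have hw : meshPoint δ L.v - meshPoint δ L.u ≠ 0 := by
      rw [sub_ne_zero]
      intro h
      have := (SimpleGraph.mem_edgeSet _).1 L.edge_mem
      exact this.ne (DiscreteDobrushin.meshPoint_injective hδ.ne' h).symm
    have hz₁ : L.z₀ ∈ frontier U₁ := by rw [hf₁]; exact Or.inl hz₀
    have hz₂ : L.z₀ ∈ frontier U₂ := by rw [hf₂]; exact Or.inl hz₀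
    have hquw' : inner (ℝ) (qu - L.z₀) (meshPoint δ L.v - meshPoint δ L.u) < 0 := by
      rw [show meshPoint δ L.v - meshPoint δ L.u = -(meshPoint δ L.u - meshPoint δ L.v) from (neg_sub _ _).symm,
        inner_neg_right]; linarith
    have hsplit := sector_split (Ω := D.carrier) hU₁o hU₂o hdisj hχcl hD hfr hz₁ hz₂ hw L.ball_subset hsec
      hqv hqvw hqu hquw'
    have hvside := hsame _ _ hqvs (hBU _ L.v_mem)
    have huside := hsame _ _ hqus (hBU _ L.u_mem)
    rcases hsplit with ⟨h1, h2⟩ | ⟨h1, h2⟩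
    · exact Or.inl ⟨hvside.1 h1, huside.2 h2⟩
    · exact Or.inr ⟨hvside.2 h1, huside.1 h2⟩
  have hoA := horient La hz₀a hsecA haUa haVa
  have hoB := horient Lb hz₀b hsecB haUb haVb
  -- the labels
  set SA : Set (Site 2) := {x | x ∈ (⟨D.carrier, δ, ∅, ∅⟩ : DiscreteDobrushin).zdBoundary ∧ meshPoint δ x ∈ U₁} with hSA
  set SB : Set (Site 2) := {x | x ∈ (⟨D.carrier, δ, ∅, ∅⟩ : DiscreteDobrushin).zdBoundary ∧ meshPoint δ x ∈ U₂} with hSB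
  -- adjacent sites on different sides span a cut edge
  have hadj_zd : ∀ {x y : Site 2}, (discreteDomainGraph D.carrier δ).Adj x y → (zdGraph 2).Adj x y := fun h =>
    meshGraph_le_zdGraph _ _ (discreteDomainGraph_le_meshGraph _ _ h)
  have hua_va : (zdGraph 2).Adj La.u La.v := hadj_zd ((SimpleGraph.mem_edgeSet _).1 La.edge_mem)
  have hub_vb : (zdGraph 2).Adj Lb.u Lb.v := hadj_zd ((SimpleGraph.mem_edgeSet _).1 Lb.edge_mem)
  have hcut : ∀ x ∈ (⟨D.carrier, δ, ∅, ∅⟩ : DiscreteDobrushin).zdBoundary,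
      ∀ y ∈ (⟨D.carrier, δ, ∅, ∅⟩ : DiscreteDobrushin).zdBoundary,
      (discreteDomainGraph D.carrier δ).Adj x y → meshPoint δ x ∈ U₁ → meshPoint δ y ∈ U₂ →
      s(x, y) = s(La.u, La.v) ∨ s(x, y) = s(Lb.u, Lb.v) := by
    intro x hx y hy hxy hxU hyU
    by_contra hne
    rw [not_or] at hne
    have hxy' := hadj_zd hxy
    have hdis : Disjoint (segment ℝ (meshPoint δ x) (meshPoint δ y)) χ := Set.disjoint_left.2 fun z hz hzχ => by
      rcases hedge x hx y hy hxy ⟨hzχ, hz⟩ with h | h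
      · rw [h, La.pstar_eq] at hz
        exact hne.1 (sym2_eq_of_midpoint_mem_segment hδ hua_va hxy' hz)
      · rw [mem_singleton_iff] at h; rw [h, Lb.pstar_eq] at hz
        exact hne.2 (sym2_eq_of_midpoint_mem_segment hδ hub_vb hxy' hz)
    have hseg : segment ℝ (meshPoint δ x) (meshPoint δ y) ⊆ closure D.carrier :=
      (meshGraph_adj_iff.1 (discreteDomainGraph_le_meshGraph _ _ hxy)).2
    have := (mem_of_segment hU₁o hU₂o hdisj hχcl hD hfr hseg hdis).1 hxU (Or.inr hyU)
    exact Set.disjoint_left.1 hdisj this hyU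
  have hcut' : ∀ x ∈ (⟨D.carrier, δ, ∅, ∅⟩ : DiscreteDobrushin).zdBoundary,
      ∀ y ∈ (⟨D.carrier, δ, ∅, ∅⟩ : DiscreteDobrushin).zdBoundary,
      (discreteDomainGraph D.carrier δ).Adj x y → meshPoint δ x ∈ U₂ → meshPoint δ y ∈ U₁ →
      s(x, y) = s(Lb.u, Lb.v) ∨ s(x, y) = s(La.u, La.v) := by
    intro x hx y hy hxy hxU hyU
    rw [Sym2.eq_swap]
    exact (hcut y hy x hx hxy.symm hyU hxU).symm
  -- the set of two-coloured edges
  have hea : s(La.u, La.v) ∈ {e | e ∈ (discreteDomainGraph D.carrier δ).edgeSet ∧ (∃ x ∈ e, x ∈ SA) ∧ ∃ y ∈ e, y ∈ SB} := by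
    refine ⟨La.edge_mem, ?_, ?_⟩
    · rcases hoA with ⟨h1, -⟩ | ⟨-, h2⟩
      · exact ⟨La.v, Sym2.mem_mk_right _ _, La.v_mem, h1⟩
      · exact ⟨La.u, Sym2.mem_mk_left _ _, La.u_mem, h2⟩
    · rcases hoA with ⟨-, h2⟩ | ⟨h1, -⟩
      · exact ⟨La.u, Sym2.mem_mk_left _ _, La.u_mem, h2⟩
      · exact ⟨La.v, Sym2.mem_mk_right _ _, La.v_mem, h1⟩
  have heb : s(Lb.u, Lb.v) ∈ {e | e ∈ (discreteDomainGraph D.carrier δ).edgeSet ∧ (∃ x ∈ e, x ∈ SA) ∧ ∃ y ∈ e, y ∈ SB} := by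
    refine ⟨Lb.edge_mem, ?_, ?_⟩
    · rcases hoB with ⟨h1, -⟩ | ⟨-, h2⟩
      · exact ⟨Lb.v, Sym2.mem_mk_right _ _, Lb.v_mem, h1⟩
      · exact ⟨Lb.u, Sym2.mem_mk_left _ _, Lb.u_mem, h2⟩
    · rcases hoB with ⟨-, h2⟩ | ⟨h1, -⟩
      · exact ⟨Lb.u, Sym2.mem_mk_left _ _, Lb.u_mem, h2⟩
      · exact ⟨Lb.v, Sym2.mem_mk_right _ _, Lb.v_mem, h1⟩
  have hSχ : {e | e ∈ (discreteDomainGraph D.carrier δ).edgeSet ∧ (∃ x ∈ e, x ∈ SA) ∧ ∃ y ∈ e, y ∈ SB} =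
      {s(La.u, La.v), s(Lb.u, Lb.v)} := by
    refine Subset.antisymm ?_ (by
      rintro e (rfl | rfl)
      · exact hea
      · exact heb)
    intro e he
    induction e using Sym2.ind with
    | h x y =>
      obtain ⟨he, ⟨x', hx', hx'A⟩, y', hy', hy'B⟩ := he
      have hxy := (SimpleGraph.mem_edgeSet _).1 he
      have key : s(x, y) = s(La.u, La.v) ∨ s(x, y) = s(Lb.u, Lb.v) := by
        rcases Sym2.mem_iff.1 hx' with rfl | rfl <;> rcases Sym2.mem_iff.1 hy' with rfl | rfl
        · exact absurd hy'B.2 (fun h => Set.disjoint_left.1 hdisj hx'A.2 h)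
        · exact hcut _ hx'A.1 _ hy'B.1 hxy hx'A.2 hy'B.2
        · exact (hcut' _ hy'B.1 _ hx'A.1 hxy hy'B.2 hx'A.2).symm
        · exact absurd hy'B.2 (fun h => Set.disjoint_left.1 hdisj hx'A.2 h)
      rcases key with h | h
      · exact Or.inl h
      · exact Or.inr h
  have hne_ab : s(La.u, La.v) ≠ s(Lb.u, Lb.v) := by
    intro h
    have h1 := La.meshPoint_u_mem
    have h2 := Lb.meshPoint_u_mem
    have h3 := Lb.meshPoint_v_mem
    rw [mem_ball] at h1 h2 h3
    have hW : ∀ z : ℂ, dist z (D.pt 0) < η₁ + 5 * δ → dist z (D.pt 1) < η₁ + 5 * δ → False := by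
      intro z hz1 hz2; have := dist_triangle_left (D.pt 0) (D.pt 1) z; linarith
    rcases (Sym2.eq_iff.1 h) with ⟨hu, -⟩ | ⟨hu, -⟩
    · exact hW _ h1 (hu ▸ h2)
    · exact hW _ h1 (hu ▸ h3)
  -- distance to the arcs: the frontier points of the two sides off `χ`
  have hχfr : ∀ z ∈ χ, z ∉ D.carrier → z = La.c ∨ z = Lb.c := by
    intro z hz hzΩ
    by_contra h; rw [not_or] at h
    exact hzΩ (hχΩ ⟨hz, by rw [mem_insert_iff, mem_singleton_iff, not_or]; exact h⟩)
  have hm01 : D.mark 0 < D.mark 1 := D.strictMono_mark (by decide)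
  have hm0 : D.nextMark 0 = D.mark 1 := by
    unfold MarkedDomain.nextMark; simp
  have hm1 : D.nextMark 1 = D.mark 0 + 1 := by
    unfold MarkedDomain.nextMark; simp
  have harc0 : D.arc 0 = D.boundary '' Icc (D.mark 0) (D.mark 1) := by
    unfold MarkedDomain.arc; rw [hm0]
  have harc1 : D.arc 1 = D.boundary '' Icc (D.mark 1) (D.mark 0 + 1) := by
    unfold MarkedDomain.arc; rw [hm1]
  have ha0 : D.pt 0 ∈ D.arc 0 := D.pt_mem_arc_self 0
  have hb0 : D.pt 1 ∈ D.arc 0 := by simpa using D.pt_succ_mem_arc 0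
  have hb1 : D.pt 1 ∈ D.arc 1 := D.pt_mem_arc_self 1
  have ha1 : D.pt 0 ∈ D.arc 1 := by simpa using D.pt_succ_mem_arc 1
  have hnear' : ∀ z ∈ χ, dist z (D.pt 0) < η₁ ∨ dist z (D.pt 1) < η₁ ∨ 20 * δ < infDist z (frontier D.carrier) :=
    fun z hz => (hnear z hz).imp mem_ball.1 (fun h => h.imp mem_ball.1 id)
  have hca : dist La.c (D.pt 0) < η₁ := La.subset_ball (Or.inl La.arcP.right_mem)
  have hcb : dist Lb.c (D.pt 1) < η₁ := Lb.subset_ball (Or.inl Lb.arcP.right_mem)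
  have hfrU₁ : ∀ f ∈ frontier U₁, f ∉ D.carrier → f ∉ χ → infDist f (D.arc 0) ≤ η := by
    intro f hf _ hfχ
    rw [hf₁] at hf
    rcases hf with h | ⟨u, hu, rfl⟩
    · exact absurd h hfχ
    rcases lt_or_ge u (D.mark 0) with h0 | h0
    · have : |u - D.mark 0| ≤ κ₀ := by rw [abs_of_neg (by linarith)]; rw [abs_lt] at hsm; linarith [hu.1]
      exact (infDist_le_dist_of_mem ha0).trans (hloc₀ u this).le
    rcases le_or_gt u (D.mark 1) with h1 | h1
    · rw [infDist_zero_of_mem (by rw [harc0]; exact mem_image_of_mem _ ⟨h0, h1⟩)]; exact hη.le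
    · have : |u - D.mark 1| ≤ κ₁ := by rw [abs_of_pos (by linarith)]; rw [abs_lt] at htm; linarith [hu.2]
      exact (infDist_le_dist_of_mem hb0).trans (hloc₁ u this).le
  have hfrU₂ : ∀ f ∈ frontier U₂, f ∉ D.carrier → f ∉ χ → infDist f (D.arc 1) ≤ η := by
    intro f hf _ hfχ
    rw [hf₂] at hf
    rcases hf with h | ⟨u, hu, rfl⟩
    · exact absurd h hfχ
    rcases lt_or_ge u (D.mark 1) with h0 | h0
    · have : |u - D.mark 1| ≤ κ₁ := by rw [abs_of_neg (by linarith)]; rw [abs_lt] at htm; linarith [hu.1]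
      exact (infDist_le_dist_of_mem hb1).trans (hloc₁ u this).le
    rcases le_or_gt u (D.mark 0 + 1) with h1 | h1
    · rw [infDist_zero_of_mem (by rw [harc1]; exact mem_image_of_mem _ ⟨h0, h1⟩)]; exact hη.le
    · have : |u - 1 - D.mark 0| ≤ κ₀ := by rw [abs_of_pos (by linarith)]; rw [abs_lt] at hsm; linarith [hu.2]
      have hper : D.boundary u = D.boundary (u - 1) := by
        rw [show u = u - 1 + 1 by ring, D.periodic_boundary]; ring_nf
      rw [hper]
      exact (infDist_le_dist_of_mem ha1).trans (hloc₀ (u - 1) this).le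
  -- assemble
  refine ⟨SA, SB, ⟨?_, ?_, ?_, ?_, ?_, ?_, ?_, ?_, ?_, ?_⟩, ?_⟩
  · -- union
    ext x
    constructor
    · rintro (h | h); exacts [h.1, h.1]
    · intro hx
      rcases hBU x hx with h | h
      · exact Or.inl ⟨hx, h⟩
      · exact Or.inr ⟨hx, h⟩
  · exact Set.disjoint_left.2 fun x hxA hxB => Set.disjoint_left.1 hdisj hxA.2 hxB.2
  · rcases hoA with ⟨h1, -⟩ | ⟨-, h2⟩
    · exact ⟨La.v, La.v_mem, h1⟩
    · exact ⟨La.u, La.u_mem, h2⟩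
  · rcases hoA with ⟨-, h2⟩ | ⟨h1, -⟩
    · exact ⟨La.u, La.u_mem, h2⟩
    · exact ⟨La.v, La.v_mem, h1⟩
  · intro y hy
    exact not_closedBall_subset_side hΩ hδ hfin hU₁o hU₂o hdisj hcover La.hv Lb.hv hbVa hbUa hbVb hbUb
      La.nondeg Lb.nondeg hcut hy.1 hy.2
  · intro x hx
    have hcover' : D.carrier \ χ ⊆ U₂ ∪ U₁ := by rw [union_comm]; exact hcover
    exact not_closedBall_subset_side hΩ hδ hfin hU₂o hU₁o hdisj.symm hcover' Lb.hv La.hv hbVb hbUb hbVa hbUa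
      Lb.nondeg La.nondeg hcut' hx.1 hx.2
  · intro y hy
    exact infDist_arc_le_side hΩ hδ hU₁o hU₂o hdisj hχcl hD hfr hU₁Ω hη.le ha0 hb0 hca hcb hχfr hfrU₁ hnear' hy.1 hy.2
  · intro x hx
    have hD' : D.carrier ⊆ U₂ ∪ U₁ ∪ χ := by rw [union_comm U₂]; exact hD
    have hfr' : frontier U₂ ∩ frontier U₁ ⊆ χ := by rw [inter_comm]; exact hfr
    exact infDist_arc_le_side hΩ hδ hU₂o hU₁o hdisj.symm hχcl hD' hfr' hU₂Ω hη.le ha1 hb1 hca hcb hχfr hfrU₂ hnear'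
      hx.1 hx.2
  · rw [hSχ, ncard_pair hne_ab]
  · intro e he hxA hyB
    have hmem : e ∈ ({s(La.u, La.v), s(Lb.u, Lb.v)} : Set _) := by rw [← hSχ]; exact ⟨he, hxA, hyB⟩
    rcases hmem with rfl | rfl
    · simp only [forall_mem_sym2_iff]; exact La.existsUnique_inner
    · simp only [forall_mem_sym2_iff]; exact Lb.existsUnique_inner
  · -- the cut midpoints are within `η₁` of the marked points
    rw [hSχ, image_pair, medialPoint_mk, medialPoint_mk]
    have hpa : (meshPoint δ La.u + meshPoint δ La.v) / 2 = La.pstar := by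
      rw [La.pstar_eq, Complex.real_smul]; push_cast; ring
    have hpb : (meshPoint δ Lb.u + meshPoint δ Lb.v) / 2 = Lb.pstar := by
      rw [Lb.pstar_eq, Complex.real_smul]; push_cast; ring
    rw [hpa, hpb]
    have hda : dist La.pstar (D.pt 0) < η₁ := La.subset_ball (Or.inl La.pstar_mem)
    have hdb : dist Lb.pstar (D.pt 1) < η₁ := Lb.subset_ball (Or.inl Lb.pstar_mem)
    have hed : ∀ {x y : ℂ}, dist x y < η₁ → edist x y ≤ ENNReal.ofReal η₁ := fun h => by
      rw [edist_dist]; exact ENNReal.ofReal_le_ofReal h.le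
    refine hausdorffEDist_le_of_mem_edist ?_ ?_
    · rintro x (rfl | rfl)
      · exact ⟨D.pt 0, Or.inl rfl, hed hda⟩
      · exact ⟨D.pt 1, Or.inr rfl, hed hdb⟩
    · rintro y (rfl | rfl)
      · exact ⟨La.pstar, Or.inl rfl, by rw [edist_comm]; exact hed hda⟩
      · exact ⟨Lb.pstar, Or.inr rfl, by rw [edist_comm]; exact hed hdb⟩

end Summit.CriticalPhenomena.CardyFormulaZ2.Theorems.DiscretisationFamilyExists

end
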